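import Summits.ValiantsHypothesis.ValiantsHypothesis.Theorems.AnyonJetsUniformJetUpperBoundWitness

/-!
# Route `AnyonJets`, crux `UniformJetUpperBound` (stmt-ValiantsHypothesis-16739) — registered stub
# `stub_pencilVNP` (line `birth`): the inversion pencil with variable coupling is p-definable over `ℂ`

The registered stub, VERBATIM: the family `P_n = ∑_σ (X none)^{inv σ} · ∏ᵢ X (some (σ i, i))` in the
variables `Option (Fin n × Fin n)` (`inv σ = #{(a,b) : a < b, σ b < σ a}`) is a `VNP` family over `ℂ`
in the format of Bürgisser 2000, Def. 2.5 — the instance `K = ℂ` of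
`UniformJet.isVNPFamily_pencil` (helper file `AnyonJetsUniformJetUpperBoundWitness.lean`: Valiant's
criterion written out with BCS's permutation-matrix recogniser and the inversion gadget
`∑_{j<i} Z_{(a,i)} Z_{(b,j)}`). HONEST FRAMING: serves a dormant route; nothing here bears on
`VP ≠ VNP`.

References: L. G. Valiant, STOC 1979, §4; P. Bürgisser 2000, Def. 2.5, Prop. 2.20; BCS 1997,
Prop. (21.15).
-/

noncomputable section

-- single-conjunct layout: Sub = Summit, duplicated namespace component intended
set_option linter.dupNamespace false

namespace Summit.ValiantsHypothesis.ValiantsHypothesis.Theorems.AnyonJets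

/-- **Registered stub `stub_pencilVNP`** (crux stmt-ValiantsHypothesis-16739, line `birth`; verbatim
signature): the inversion pencil `(∑_σ q^{inv σ} ∏ᵢ X_{σ i, i})_n`, `q = X none`, is a `VNP` family
over `ℂ` (`UniformJet.isVNPFamily_pencil ℂ`). [cite: Burgisser2000, Def. 2.5 and Prop. 2.20]
[cite: Valiant1979, §4] -/
theorem stub_pencilVNP :
    Literature.Computability.AlgebraicComplexity.IsVNPFamily (k := ℂ)
      (σ := fun n => Option (Fin n × Fin n))
      (fun n => ∑ σ : Equiv.Perm (Fin n),
        (MvPolynomial.X none : MvPolynomial (Option (Fin n × Fin n)) ℂ) ^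
            (Finset.univ.filter (fun p : Fin n × Fin n => p.1 < p.2 ∧ σ p.2 < σ p.1)).card *
          ∏ i : Fin n, MvPolynomial.X (some (σ i, i))) :=
  UniformJet.isVNPFamily_pencil ℂ

end Summit.ValiantsHypothesis.ValiantsHypothesis.Theorems.AnyonJets

end
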